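import Literature.NumberTheory.Weil1965.ThetaIntegralOrbitFunctionalUnitary
import Literature.NumberTheory.Automorphic.AdelicVectorPlaceSplitting
import Literature.NumberTheory.Automorphic.AdeleRingSymplecticPerfect
import Mathlib.MeasureTheory.Measure.Haar.Unique
import HarnessLib

/-!
# The geometric action of the unitary dual pair PRESERVES HAAR MEASURE on `X□(𝔸_F)` — from the perfectness of `Sp(W_𝔸)`

Topic `NumberTheory/Weil1965`; namespaces `Literature.NumberTheory.Weil1965` (§1–§2, generic) and `…Weil1965.UnitaryDoubling` (§3).
KERNEL ONLY: theorems; no definition, no named fact, no instance, no `sorry`.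

The letter `hTμ : ∀ g, MeasurePreserving (T g) μ μ` of the split-place producers of the I-CLOSE step (★ `AdelicSiegelFibreMeasureSplitPlace`,
`FibreMeasureSplitPlace`; `T g = A_h` a geometric action, ★ `H413E2SWSplitPlaceLetters` clause (4)) asks that the geometric action
`A_h = vDiagAct h = diagAct (ι_V h)` of `h ∈ U(J_V)(𝔸_F)` preserve the additive Haar measure of `X□(𝔸_F) = 𝔸_F^{n+n}`.  Classically:
`A_h` is `𝔸_F`-linear with symplectic, hence unimodular, matrix.  Here WITHOUT DETERMINANTS:

* §1 (generic, `A : G →* (𝔸_F^m ≃ₗ[𝔸_F] 𝔸_F^m)`): `exists_map_act_eq_smul` — `(A g)_* μ = c_g • μ` with `c_g > 0` (`(A g)_* μ` is an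
  additive Haar measure, ★ Mathlib `isAddLeftInvariant_eq_smul`); the scalars are multiplicative and `c_{g⁻¹} = c_g⁻¹`, so every
  COMMUTATOR preserves `μ`; hence **`map_act_eq_self_of_commutator_eq_top`**: if `commutator G = ⊤` then `(A g)_* μ = μ` for all `g`
  (`measurePreserving_act_of_commutator_eq_top`);
* §2 **`map_diagAct_eq_self`**, `measurePreserving_diagAct` — for `g ∈ Sp(W_𝔸, β_𝕋)` acting on `X□(𝔸_F)` by ★ `diagAct`, since
  `Sp(W_𝔸)` IS PERFECT (★ `commutator_symplecticGroup_adeleRing_gram_eq_top`, A-p10);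
* §3 **`map_vDiagAct_eq_self`**, **`measurePreserving_vDiagAct`** — the dual pair: `A_h = diagAct (ι_V h)` (★ `vDiagAct_apply`).

References: C. Moeglin, M.-F. Vignéras, J.-L. Waldspurger, *Correspondances de Howe sur un corps p-adique*, LNM 1291 (1987), Chap. 2
II.1 (B) (`Sp` is generated by transvections ∕ perfect) [MoeglinVignerasWaldspurger1987]; A. Weil, *Acta Math.* 111 (1964), Chap. III
n° 37 [Weil1964]; A. Weil, *Acta Math.* 113 (1965), Chap. I n° 2 p. 7 (Haar measures on `X_A`), Chap. IV n° 45–46, p. 66 (the action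
of the dual pair on `𝒮(X_A)` and on the tempered measures) [Weil1965].

USE (cell `hodgecm-mathlib`, FLOOR-0 P4, ENGINE E-2, `StubSW2` (iii), I-CLOSE letters `hTμ`).  HC_CM is proved only modulo the printed
citations until rung 0 closes.
-/

set_option autoImplicit false

noncomputable section

namespace Literature.NumberTheory.Weil1965

open _root_.MeasureTheory NumberField IsDedekindDomain
open scoped NNReal ENNReal
open Literature.NumberTheory.Automorphic

/-! ## §1 Generic: a group with trivial abelianisation acts on `X(𝔸_F)` by Haar-preserving automorphisms -/

section Generic

variable (F : Type) [Field F] [NumberField F] {m : ℕ}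
  [MeasurableSpace (AdeleRing (𝓞 F) F)] [BorelSpace (AdeleRing (𝓞 F) F)]
  {G : Type*} [Group G]
  (A : G →* ((Fin m → AdeleRing (𝓞 F) F) ≃ₗ[AdeleRing (𝓞 F) F] (Fin m → AdeleRing (𝓞 F) F)))
  (μ : Measure (Fin m → AdeleRing (𝓞 F) F)) [μ.IsAddHaarMeasure]

omit [MeasurableSpace (AdeleRing (𝓞 F) F)] [BorelSpace (AdeleRing (𝓞 F) F)] in
/-- `A g` is continuous (a linear map out of the finite free module `𝔸_F^m`). [cite: Weil1965, Chap. IV n° 45, p. 66] -/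
theorem continuous_act (g : G) : Continuous (A g) := by
  haveI : ContinuousSMul (AdeleRing (𝓞 F) F) (AdeleRing (𝓞 F) F) := ⟨continuous_mul⟩
  exact (A g).toLinearMap.continuous_on_pi

/-- `A g` is measurable. [cite: Weil1965, Chap. IV n° 45, p. 66] -/
theorem measurable_act (g : G) : Measurable (A g) := by
  haveI := AdelicVector.secondCountableTopology_pi F (Fin m)
  haveI := secondCountableTopology_adeleRing (K := F)
  haveI : BorelSpace (Fin m → AdeleRing (𝓞 F) F) := Pi.borelSpace
  exact (continuous_act F A g).measurable

omit [BorelSpace (AdeleRing (𝓞 F) F)] [μ.IsAddHaarMeasure] in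
/-- `(A (g h))_* μ = (A g)_* ((A h)_* μ)`. [cite: Weil1965, Chap. IV n° 45, p. 66] -/
theorem map_act_mul [BorelSpace (AdeleRing (𝓞 F) F)] (g h : G) :
    Measure.map (A (g * h)) μ = Measure.map (A g) (Measure.map (A h) μ) := by
  rw [Measure.map_map (measurable_act F A g) (measurable_act F A h), map_mul]
  rfl

/-- **`(A g)_* μ` is a POSITIVE MULTIPLE of `μ`**: it is again an additive Haar measure on the second countable locally compact
group `𝔸_F^m`, and Haar measure is unique up to a positive scalar. [cite: Weil1965, Chap. I n° 2, p. 7] -/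
theorem exists_map_act_eq_smul (g : G) : ∃ c : ℝ≥0, 0 < c ∧ Measure.map (A g) μ = c • μ := by
  haveI := AdelicVector.t2Space_pi F (Fin m)
  haveI := AdelicVector.secondCountableTopology_pi F (Fin m)
  haveI := AdelicVector.locallyCompactSpace_pi F (Fin m)
  haveI := secondCountableTopology_adeleRing (K := F)
  haveI : BorelSpace (Fin m → AdeleRing (𝓞 F) F) := Pi.borelSpace
  haveI : (Measure.map (A g) μ).IsAddHaarMeasure :=
    (A g).toAddEquiv.isAddHaarMeasure_map μ (continuous_act F A g) (by
      haveI : ContinuousSMul (AdeleRing (𝓞 F) F) (AdeleRing (𝓞 F) F) := ⟨continuous_mul⟩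
      exact (A g).symm.toLinearMap.continuous_on_pi)
  exact ⟨(Measure.map (A g) μ).addHaarScalarFactor μ, Measure.addHaarScalarFactor_pos_of_isAddHaarMeasure _ _,
    Measure.isAddLeftInvariant_eq_smul _ _⟩

omit [BorelSpace (AdeleRing (𝓞 F) F)] in
/-- positive scalars are determined by the Haar measure they scale: `a • μ = b • μ ⇒ a = b` (test on a compact set with
non-empty interior: positive finite measure). [folklore] -/
private theorem smul_cancel {a b : ℝ≥0} (h : a • μ = b • μ) : a = b := by
  haveI := AdelicVector.t2Space_pi F (Fin m)
  haveI := AdelicVector.locallyCompactSpace_pi F (Fin m)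
  obtain ⟨K⟩ := (inferInstance : Nonempty (TopologicalSpace.PositiveCompacts (Fin m → AdeleRing (𝓞 F) F)))
  have hpos : 0 < μ K := Measure.measure_pos_of_nonempty_interior μ K.interior_nonempty
  have hfin : μ K < ∞ := K.isCompact.measure_lt_top
  have hK := congrArg (fun ν : Measure (Fin m → AdeleRing (𝓞 F) F) => ν K) h
  simp only [Measure.smul_apply, ENNReal.smul_def, smul_eq_mul] at hK
  exact_mod_cast (ENNReal.mul_left_inj hpos.ne' hfin.ne).1 hK

omit [μ.IsAddHaarMeasure] in
/-- the scalar of a product is the product of the scalars. [cite: Weil1965, Chap. I n° 2, p. 7] -/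
private theorem scalar_mul {g h : G} {cg ch : ℝ≥0} (hg : Measure.map (A g) μ = cg • μ) (hh : Measure.map (A h) μ = ch • μ) :
    Measure.map (A (g * h)) μ = (cg * ch) • μ := by
  rw [map_act_mul F A μ g h, hh, Measure.map_smul, hg, smul_smul, mul_comm]

/-- the scalar of an inverse is the inverse of the scalar. [cite: Weil1965, Chap. I n° 2, p. 7] -/
private theorem scalar_inv {g : G} {cg : ℝ≥0} (hg : Measure.map (A g) μ = cg • μ) :
    Measure.map (A g⁻¹) μ = cg⁻¹ • μ := by
  obtain ⟨ci, -, hi⟩ := exists_map_act_eq_smul F A μ g⁻¹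
  have h1 : Measure.map (A (g⁻¹ * g)) μ = (ci * cg) • μ := scalar_mul F A μ hi hg
  rw [inv_mul_cancel, map_one, LinearEquiv.coe_one, Measure.map_id] at h1
  have h3 : (1 : ℝ≥0) = ci * cg := smul_cancel F μ (by rw [one_smul]; exact h1)
  rw [hi, eq_inv_of_mul_eq_one_left h3.symm]

/-- **HAAR INVARIANCE FROM PERFECTNESS**: if `G` has trivial abelianisation (`commutator G = ⊤`), every `A g` preserves every
additive Haar measure on `𝔸_F^m` — the scalar `g ↦ c_g` (`(A g)_* μ = c_g • μ`) is multiplicative and kills commutators, and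
`G` is generated by commutators.  (No determinants are computed.) [cite: MoeglinVignerasWaldspurger1987, Chap. 2 II.1 (B)] -/
theorem map_act_eq_self_of_commutator_eq_top (hG : commutator G = ⊤) (g : G) : Measure.map (A g) μ = μ := by
  -- the subgroup of `μ`-preserving elements
  let S : Subgroup G :=
    { carrier := {g | Measure.map (A g) μ = μ}
      one_mem' := by
        change Measure.map (A 1) μ = μ
        rw [map_one, LinearEquiv.coe_one, Measure.map_id]
      mul_mem' := fun {a b} ha hb => by
        change Measure.map (A (a * b)) μ = μ
        rw [map_act_mul F A μ a b, hb, ha]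
      inv_mem' := fun {a} ha => by
        change Measure.map (A a⁻¹) μ = μ
        have h := scalar_inv F A μ (g := a) (cg := 1) (by rw [one_smul]; exact ha)
        rwa [inv_one, one_smul] at h }
  -- every commutator lies in `S`
  have hcomm : ∀ a b : G, a * b * a⁻¹ * b⁻¹ ∈ S := by
    intro a b
    obtain ⟨ca, hca, ha⟩ := exists_map_act_eq_smul F A μ a
    obtain ⟨cb, hcb, hb⟩ := exists_map_act_eq_smul F A μ b
    have hai := scalar_inv F A μ ha
    have hbi := scalar_inv F A μ hb
    change Measure.map (A (a * b * a⁻¹ * b⁻¹)) μ = μ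
    rw [scalar_mul F A μ (scalar_mul F A μ (scalar_mul F A μ ha hb) hai) hbi]
    have hc : ca * cb * ca⁻¹ * cb⁻¹ = 1 := by
      field_simp
    rw [hc, one_smul]
  have hle : commutator G ≤ S := by
    rw [commutator_def]
    exact Subgroup.commutator_le.mpr fun a _ b _ => by
      rw [commutatorElement_def]
      exact hcomm a b
  have hg : g ∈ S := hle (hG ▸ Subgroup.mem_top g)
  exact hg

/-- `MeasurePreserving` form. [cite: MoeglinVignerasWaldspurger1987, Chap. 2 II.1 (B)] -/
theorem measurePreserving_act_of_commutator_eq_top (hG : commutator G = ⊤) (g : G) : MeasurePreserving (A g) μ μ :=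
  ⟨measurable_act F A g, map_act_eq_self_of_commutator_eq_top F A μ hG g⟩

end Generic

/-! ## §2 The geometric action of the adelic symplectic group preserves Haar measure -/

section Symplectic

open Literature.RepresentationTheory.HeisenbergGroup Literature.NumberTheory.Weil1964

variable (F : Type) [Field F] [NumberField F] {n : ℕ}
  [MeasurableSpace (AdeleRing (𝓞 F) F)] [BorelSpace (AdeleRing (𝓞 F) F)]
  (T : Matrix (Fin n) (Fin n) (AdeleRing (𝓞 F) F)) (hT : IsUnit T.det)
  (μ : Measure (Fin (n + n) → AdeleRing (𝓞 F) F)) [μ.IsAddHaarMeasure]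

/-- **`Sp(W_𝔸, β_𝕋)` ACTS ON `X□(𝔸_F)` BY HAAR-PRESERVING MAPS**: `(diagAct g)_* μ = μ` for every `g ∈ Sp(W_𝔸)` and every additive
Haar measure `μ` — `Sp(W_𝔸)` is perfect (★ `commutator_symplecticGroup_adeleRing_gram_eq_top`).
[cite: MoeglinVignerasWaldspurger1987, Chap. 2 II.1 (B)] [cite: Weil1964, Chap. III n° 37] -/
theorem map_diagAct_eq_self (g : symplecticGroup (polar (adelicForm F (Fin n) T))) :
    Measure.map (diagAct F T hT g) μ = μ :=
  map_act_eq_self_of_commutator_eq_top F (diagAct F T hT) μ (commutator_symplecticGroup_adeleRing_gram_eq_top F T hT) g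

/-- `MeasurePreserving` form. [cite: MoeglinVignerasWaldspurger1987, Chap. 2 II.1 (B)] -/
theorem measurePreserving_diagAct (g : symplecticGroup (polar (adelicForm F (Fin n) T))) :
    MeasurePreserving (diagAct F T hT g) μ μ :=
  measurePreserving_act_of_commutator_eq_top F (diagAct F T hT) μ (commutator_symplecticGroup_adeleRing_gram_eq_top F T hT) g

end Symplectic

end Literature.NumberTheory.Weil1965

/-! ## §3 The dual pair: `A_h = diagAct (ι_V h)` preserves Haar measure on `X□(𝔸_F)` -/

namespace Literature.NumberTheory.Weil1965.UnitaryDoubling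

open _root_.MeasureTheory NumberField IsDedekindDomain
open Literature.NumberTheory.Weil1964 Literature.NumberTheory.Weil1965 Literature.NumberTheory.Automorphic
open Literature.NumberTheory.GelbartRogawski1991 Literature.NumberTheory.GelbartRogawski1991.UnitaryDualPair

variable (F E : Type) [Field F] [NumberField F] [Field E] [NumberField E] [Algebra F E] [Algebra.IsQuadraticExtension F E]
  (c : E ≃ₐ[F] E) {δ : E} (hcδ : c δ = -δ) (hδ : δ ≠ 0) {d : F} (hd : δ * δ = algebraMap F E d)
  (N : ℕ) {n : ℕ} (e : Fin N × Fin 1 ≃ Fin n)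
  (TV : Matrix (Fin N) (Fin N) F) (hV : TV.IsSymm) (hVd : IsUnit TV.det)
  (TW : Matrix (Fin 1) (Fin 1) F) (hW : TW.IsSymm) (hWd : IsUnit TW.det)
  [MeasurableSpace (AdeleRing (𝓞 F) F)] [BorelSpace (AdeleRing (𝓞 F) F)]
  (μ : Measure (Fin (n + n) → AdeleRing (𝓞 F) F)) [μ.IsAddHaarMeasure]

/-- **THE GEOMETRIC ACTION OF `U(J_V)(𝔸_F)` PRESERVES HAAR MEASURE ON `X□(𝔸_F)`**: `(A_h)_* μ = μ` (`A_h = diagAct (ι_V h)`,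
`ι_V h ∈ Sp(W_𝔸)` and ★ `map_diagAct_eq_self`) — the letter `hTμ` of the split-place producers for every `T g = A_h`
(★ `H413E2SWSplitPlaceLetters.exists_splitPlaceLetters` clause (4)). [cite: Weil1965, Chap. IV n° 46, p. 66] -/
theorem map_vDiagAct_eq_self (h : UnitaryGroup.adelic F E c N (TV.map (algebraMap F E))) :
    Measure.map (vDiagAct F E c hcδ hδ hd N e TV hV hVd TW hW hWd h) μ = μ := by
  rw [vDiagAct_apply]
  exact map_diagAct_eq_self F (adelicGram F e TV TW) (isUnit_det_adelicGram F e hVd hWd) μ _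

/-- `MeasurePreserving` form: `hTμ`. [cite: Weil1965, Chap. IV n° 46, p. 66] -/
theorem measurePreserving_vDiagAct (h : UnitaryGroup.adelic F E c N (TV.map (algebraMap F E))) :
    MeasurePreserving (vDiagAct F E c hcδ hδ hd N e TV hV hVd TW hW hWd h) μ μ := by
  rw [vDiagAct_apply]
  exact measurePreserving_diagAct F (adelicGram F e TV TW) (isUnit_det_adelicGram F e hVd hWd) μ _

end Literature.NumberTheory.Weil1965.UnitaryDoubling
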